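import Mathlib

/-!
# The entropy price of a split atom dominates `1.86 ×` its kept value

Crux `Summit.MatrixMultiplication.MatrixMultiplication.Theses.SnSubsetDichotomy.PolynomialSlack`
(item `stmt-MatrixMultiplication-8306`), line transport-split-hull (lead c9, all-split endgame).
An atom with masses `σ, ρ ≥ 0`, split (`σ + ρ ≤ 1 + h`), and block exponent
`ξ ∈ [1/4 - κ, 3/4 + κ]` is priced by the entropy certificate at `σ(1 - ξ) + ρ ξ` (in units of
`log n`); this elementary inequality converts the price into `≥ 1.86·σρ/(1 + h) - κ(σ + ρ)`
(`atom_exponent_ge`).  The sharp constant is `1 + √3/2 ≈ 1.866`.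
-/

namespace Summit.MatrixMultiplication.MatrixMultiplication.Theorems.PolynomialSlack

set_option linter.dupNamespace false

open scoped BigOperators

/-- **Entropy price of a split atom.** For `σ, ρ, h, κ ≥ 0` with `σ + ρ ≤ 1 + h` and
`1/4 - κ ≤ ξ ≤ 3/4 + κ` one has `1.86·σρ/(1 + h) - κ(σ + ρ) ≤ σ(1 - ξ) + ρ ξ`.
Proof: the right side is affine in `ξ`, so on the interval it is at least
`min((3σ + ρ)/4, (σ + 3ρ)/4) - κ(σ + ρ)` (case split on `σ ≤ ρ`), and
`(σ + 3ρ)(1 + h) ≥ (σ + 3ρ)(σ + ρ) = σ² + 4σρ + 3ρ² ≥ 7.44 σρ` because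
`σ² - 3.44σρ + 3ρ² = (σ - 1.72ρ)² + 0.0416ρ² ≥ 0` (and symmetrically). [folklore] -/
theorem atom_exponent_ge (σ ρ ξ h κ : ℝ) (hσ : 0 ≤ σ) (hρ : 0 ≤ ρ) (hh : 0 ≤ h) (hκ : 0 ≤ κ)
    (hsplit : σ + ρ ≤ 1 + h) (hξ1 : 1 / 4 - κ ≤ ξ) (hξ2 : ξ ≤ 3 / 4 + κ) :
    186 / 100 * (σ * ρ) / (1 + h) - κ * (σ + ρ) ≤ σ * (1 - ξ) + ρ * ξ := by
  have h1 : 0 < 1 + h := by linarith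
  -- the two quadratic facts `1.86 σρ/(1+h) ≤ (σ + 3ρ)/4, (3σ + ρ)/4`
  have hA : 186 / 100 * (σ * ρ) / (1 + h) ≤ (σ + 3 * ρ) / 4 := by
    rw [div_le_iff₀ h1]
    nlinarith [sq_nonneg (σ - 172 / 100 * ρ), sq_nonneg ρ, mul_nonneg hσ hρ,
      mul_nonneg (show (0 : ℝ) ≤ σ + 3 * ρ by linarith) (sub_nonneg.2 hsplit)]
  have hB : 186 / 100 * (σ * ρ) / (1 + h) ≤ (3 * σ + ρ) / 4 := by
    rw [div_le_iff₀ h1]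
    nlinarith [sq_nonneg (ρ - 172 / 100 * σ), sq_nonneg σ, mul_nonneg hσ hρ,
      mul_nonneg (show (0 : ℝ) ≤ 3 * σ + ρ by linarith) (sub_nonneg.2 hsplit)]
  rcases le_total ρ σ with hle | hle
  · -- `σ ≥ ρ`: `σ(1-ξ) + ρξ = σ - (σ-ρ)ξ` is non-increasing in `ξ`; evaluate at `ξ = 3/4 + κ`
    have key : (σ + 3 * ρ) / 4 - κ * (σ + ρ) ≤ σ * (1 - ξ) + ρ * ξ := by
      nlinarith [mul_nonneg (sub_nonneg.2 hle) (sub_nonneg.2 hξ2), mul_nonneg hκ hρ]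
    linarith
  · -- `σ ≤ ρ`: non-decreasing in `ξ`; evaluate at `ξ = 1/4 - κ`
    have key : (3 * σ + ρ) / 4 - κ * (σ + ρ) ≤ σ * (1 - ξ) + ρ * ξ := by
      nlinarith [mul_nonneg (sub_nonneg.2 hle) (sub_nonneg.2 hξ1), mul_nonneg hκ hσ]
    linarith

end Summit.MatrixMultiplication.MatrixMultiplication.Theorems.PolynomialSlack
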